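import Literature.MathematicalPhysics.QuantumFieldTheory.Balaban1983to89.B9RWSumsDefinitePinsPairM
import Literature.MathematicalPhysics.QuantumFieldTheory.Balaban1983to89.B9GeoNbrCountKLevelV1

/-!
# BalabanUVNodes ∕ N06 ([B9], `Dag.B9_main`) — THE NUMERIC SIDE CONDITIONS OF THE STAGE-11 CERTIFICATE, EDITION 42 (rows 18's mixed factor
# `FactorsL2Mixed37Dir` DERIVED at named constants), ARE JOINTLY SATISFIABLE: the edition-39∕40∕41 witness of `BalabanUVNodesN06NumericsWitness`
# (`numerics_inhabited_ed39`, dag-n06-d) extended by the four numeric binders the knit of `BalabanUVNodesN06MixedFactorAtPinsPhys` adds — a second witness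
# file (the first is at its length budget), written by the width seat `pub-ymgap-dag-n06-w7` (g2) for the knit seat `pub-ymgap-dag-n06-d`

Track A of `YM-PLAN.md` (cell `pub-ymgap`, HUMAN RULING D-0062), node **N06** = [Balaban1985BackgroundPropagators] Thms 3.1–3.15.  A REFEREE AID (A6 on the
numerics), not a certificate edition; the pattern, statement order and values are dag-n06-d's (`BalabanUVNodesN06NumericsWitness`, editions 25–39).

WHAT.  Edition 42 of the certificate (the knit seat's next edition, announced in its g12 close) drops the displayed conjunct `FactorsL2Mixed37Dir (𝔬 x) (𝔡 x) (𝔩 x) 1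
(H x) pM.θM p.δ₀ U` of `h36H` and derives it by `N06MixedFactorAtPinsPhys.factorsL2Mixed37Dir_of_pins` at the NAMED constants `MRec aRec BRec δRec` of
`B9RWSums346MixedFactorAtRecordClosed`, which costs FOUR new pure-numeric binders: `hM1fac : MRec … ≤ p.M₁`, `ha1fac : p.a₁ ≤ aRec …`, `hδfac : p.δ₀ ≤ δRec …`,
`hθfac : p.θ₀ * Real.exp ((3/4 + p.δ₀) * p.ρ) * BRec … ≤ pM.θM`.  ★ `numerics_inhabited_ed42`: the pure-numeric hypotheses of edition 39 (= 40 = 41: editions 40∕41 touched no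
numeric binder) PLUS these four — quantified, like the mixed-leg constants `MMx aMx BMx δMx`, over ARBITRARY positive reals `MRc aRc BRc δRc` standing for the named
constants — are JOINTLY SATISFIABLE: dag-n06-d's edition-39 witness with `p.M₁ := max 1 (max MMx MRc)`, `p.a₁ := min 1 (min aMx aRc)`, the rate scale
`s := min 1 (min δ₄ (min δMx δRc))`, and `p.θ₀ = 0`, `p.ρ = 0`, `pM.θM = 0` (so the θ-bound reads `0 ≤ 0`); the four new conjuncts are listed right after
`(p.δ₀ ≤ δMx)` and before `(W ≤ pM.NM)` (display the four binders right after `hδmix` to keep the certificate's order).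
HONEST FRAMING.  Arithmetic only; says nothing about the inhabitation of the displayed SCHEMAS at these numerics (the node's content); COUNT-NEUTRAL; N06 NOT
discharged; K1⁹ NOT closed.  One finite 𝕋⁴ programme at fixed `ε` — NOT continuum, NOT OS, NOT the mass gap ∕ Clay; no summit statement is proved here.  0 `def`, 0 `sorry`.
-/

noncomputable section

namespace Summit.QuantumFields.YangMills.BalabanUVNodes.N06NumericsWitnessB

open Literature.MathematicalPhysics.QuantumFieldTheory.Balaban1983to89
open Literature.MathematicalPhysics.QuantumFieldTheory.Balaban1983to89.B9RWSumsDefinitePins (PinPrims)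
open Literature.MathematicalPhysics.QuantumFieldTheory.Balaban1983to89.B9RWSumsDefinitePinsPair (PairPrims)
open Literature.MathematicalPhysics.QuantumFieldTheory.Balaban1983to89.B9RWSumsDefinitePinsPairM (MixedPrims)
open Literature.MathematicalPhysics.QuantumFieldTheory.Balaban1983to89.B9GeoNbrCountKLevelV1 (nbrM₀Y)

/-- ★ **EDITION 42** (rows 18's `FactorsL2Mixed37Dir` derived at the named constants `MRec aRec BRec δRec` of dag-n06-w7's `B9RWSums346MixedFactorAtRecordClosed`): the
pure-numeric hypotheses of edition 39 PLUS the four new binders `MRc ≤ p.M₁`, `p.a₁ ≤ aRc`, `p.δ₀ ≤ δRc`, `p.θ₀·e^{(3/4 + p.δ₀)p.ρ}·BRc ≤ pM.θM` — for ARBITRARY positive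
`MRc aRc BRc δRc` — are JOINTLY SATISFIABLE: the edition-39 witness with `M₁ := max 1 (max MMx MRc)`, `a₁ := min 1 (min aMx aRc)`, `s := min 1 (min δ₄ (min δMx δRc))`
(`p.θ₀ = p.ρ = pM.θM = 0`).  The threshold `MRc ≤ p.M₁` is M-side, `p.a₁ ≤ aRc` and `p.δ₀ ≤ δRc` are upper bounds by fixed positive constants (degree-1 homogeneous-safe),
`pM.θM` is bounded from below only (`MixedPrims.OK` asks `0 ≤ θM`).
[cite: Balaban1985BackgroundPropagators, (3.88)–(3.89) p.409 + (3.46) p.398 + Cor 3.6 p.408 + Thms 3.1–3.15 pp.397–432 (the displayed rate∕threshold side conditions); Balaban1984PropagatorsII, Lemma 2.1 (2.60)–(2.61) p.234 (bookkeeping)] -/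
theorem numerics_inhabited_ed42 (d ℓ : ℕ) (hd : 1 ≤ d + 1) (hL : Odd (ℓ + 1) ∧ 1 < ℓ + 1) (b₀ b₁ : ℝ) :
    ∃ Mstar : ℕ, ∀ δ₄ : ℝ, 0 < δ₄ → ∀ MMx aMx BMx δMx W : ℝ, 0 < MMx → 0 < aMx → 0 < BMx → 0 < δMx → 0 ≤ W →
      ∀ MRc aRc BRc δRc : ℝ, 0 < MRc → 0 < aRc → 0 < BRc → 0 < δRc → ∃ (α' r39 δ39 B39 a39 M39 a311 M311 : ℝ) (p q : PinPrims) (p3 q3 : PairPrims) (pM qM : MixedPrims)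
      (δ12₀ δK12 σ12 ρ12 a12 M12 B12₃ δ12₃ ρ13 α12 θ₂ ρf12 : ℝ) (Bq12 : ℝ → ℝ) (t12 δT12 ρS σS B13₄ : ℝ)
      (θV13 Br13 BhD13 Bx13 Bd13 : ℝ → ℝ) (Bd2₁₃ : ℝ → ℝ → ℝ) (tJ δB rT δ₂ : ℝ) (Bx0 BdX : ℝ → ℝ) (a₀E δ₁E B₁E : ℝ),
      (0 < α') ∧ (α' < 1) ∧ (0 < r39) ∧ (r39 ≤ δ39) ∧ (0 < B39) ∧ (0 < a39) ∧ (0 < M39) ∧ (0 < a311) ∧ (0 < M311) ∧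
      p.OK ∧ q.OK ∧ p3.OK ∧ q3.OK ∧ pM.OK ∧ qM.OK ∧
      (nbrM₀Y d ℓ hd hL b₀ b₁ 2 ≤ Mstar) ∧ (nbrM₀Y d ℓ hd hL b₀ b₁ ((ℓ : ℝ) + 4) ≤ Mstar) ∧
      (0 ≤ θ₂) ∧ (0 < ρf12) ∧ (ρf12 + σ12 ≤ (1 - α12) * ρ12) ∧ (ρf12 + 2 * σ12 + α12 * ρ12 ≤ ρ12) ∧ (∀ β, 0 ≤ Bq12 β) ∧ (0 ≤ B12₃) ∧
      (0 < σ12) ∧ (0 < ρ12) ∧ (ρ12 ≤ δ12₀) ∧ (ρ12 + σ12 ≤ δK12) ∧ (ρ12 + σ12 ≤ δ12₃) ∧ (0 < a12) ∧ (0 < M12) ∧ (0 < α12) ∧ (α12 ≤ 1 / 2) ∧ (δ12₃ ≤ δ12₀) ∧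
      (δ12₀ ≤ (1 - 3 * q.αF) * ((1 - 2 * q.α) * q.δ₀)) ∧
      (0 ≤ t12) ∧ (0 < σS) ∧ (ρS ≤ δT12) ∧ (ρS + σS ≤ δ12₀) ∧ (ρS + σS ≤ δ12₃) ∧ (δK12 + q.αF * ((1 - 2 * q.α) * q.δ₀) ≤ ρS) ∧
      (M311 ≤ M12) ∧ (a12 ≤ a311) ∧ (σS ≤ δK12) ∧ (0 < ρ13) ∧ (ρ13 + 5 * σ12 ≤ ρ12) ∧ (3 * σ12 < (1 - α12) * ρ13) ∧
      (∀ ε, 0 < ε → 0 ≤ θV13 ε) ∧ (0 ≤ B13₄) ∧ (∀ ε, 0 < ε → 0 ≤ Br13 ε) ∧ (∀ β, 0 ≤ β → β < 1 → 0 ≤ BhD13 β) ∧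
      (∀ β, 0 ≤ β → β < 1 → 0 ≤ Bx13 β) ∧ (∀ ε, 0 < ε → ε ≤ 1 → 0 ≤ Bd13 ε) ∧ (∀ ε β, 0 < ε → ε ≤ 1 → 0 ≤ β → β < 1 → 0 ≤ Bd2₁₃ ε β) ∧
      (0 ≤ tJ) ∧ (rT ≤ min ((1 - 2 * p.α) * p.δ₀) δ39 / 8) ∧ (rT ≤ δB) ∧ (0 ≤ δT12) ∧ (δT12 + 3 * σS + 3 * (q.αF * ((1 - 2 * q.α) * q.δ₀)) ≤ rT) ∧
      (∀ β, 0 ≤ β → β < 1 → 0 ≤ Bx0 β) ∧ (∀ β, 0 ≤ β → β < 1 → 0 ≤ BdX β) ∧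
      (0 < a₀E) ∧ (0 < δ₁E) ∧ (0 < B₁E) ∧ (rT ≤ δ₄) ∧ (rT ≤ δ₂) ∧ (δ12₃ ≤ (1 - 2 * q.αF) * rT - σS) ∧
      (MMx ≤ p.M₁) ∧ (p.a₁ ≤ aMx) ∧ (BMx ≤ pM.BM) ∧ (p.δ₀ ≤ δMx) ∧
      (MRc ≤ p.M₁) ∧ (p.a₁ ≤ aRc) ∧ (p.δ₀ ≤ δRc) ∧ (p.θ₀ * Real.exp ((3 / 4 + p.δ₀) * p.ρ) * BRc ≤ pM.θM) ∧ (W ≤ pM.NM) := by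
  -- as `numerics_inhabited_ed39`, with `M₁ := max 1 (max MMx MRc)`, `a₁ := min 1 (min aMx aRc)`, `s := min 1 (min δ₄ (min δMx δRc))`; `θ₀ = 0` makes the θ-bound `0 ≤ 0`
  refine ⟨max (nbrM₀Y d ℓ hd hL b₀ b₁ 2) (nbrM₀Y d ℓ hd hL b₀ b₁ ((ℓ : ℝ) + 4)), fun δ₄ hδ₄ MMx aMx BMx δMx W hMMx haMx hBMx hδMx hW MRc aRc BRc δRc hMRc haRc hBRc hδRc => ?_⟩
  set s : ℝ := min 1 (min δ₄ (min δMx δRc)) with hsdef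
  have hs : 0 < s := lt_min one_pos (lt_min hδ₄ (lt_min hδMx hδRc))
  have hs4 : s ≤ δ₄ := (min_le_right _ _).trans (min_le_left _ _)
  have hsM : s ≤ δMx := (min_le_right _ _).trans ((min_le_right _ _).trans (min_le_left _ _))
  have hsR : s ≤ δRc := (min_le_right _ _).trans ((min_le_right _ _).trans (min_le_right _ _))
  let pp : PinPrims :=
    { α := 1 / 4, ρ := 0, Nc := 0, N' := 0, NF := 0, Cℓ := 1, Kc := 0, θ₀ := 0, B₀ := 1, δ₀ := s, a₁ := min 1 (min aMx aRc), M₁ := max 1 (max MMx MRc), αF := 1 / 1000,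
      NH := 0, NL := 0, BL := 0, NI := 0, N2 := 0, B2 := 0, θ2 := 0, Bl := fun _ => 0, Bt := fun _ => 0, BI := fun _ => 0, θI := fun _ => 0,
      BI2 := fun _ _ => 0 }
  have hpp : pp.OK :=
    { α_pos := by norm_num [pp], α_lt := by norm_num [pp], Nc_nn := le_rfl, N'_nn := le_rfl, NF_nn := le_rfl, one_le_Cℓ := le_rfl, Kc_nn := le_rfl,
      θ₀_nn := le_rfl, B₀_pos := by norm_num [pp], δ₀_pos := hs, a₁_pos := lt_min one_pos (lt_min haMx haRc), M₁_pos := lt_of_lt_of_le one_pos (le_max_left _ _),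
      αF_pos := by norm_num [pp], αF_lt := by norm_num [pp], NH_nn := le_rfl, NL_nn := le_rfl, BL_nn := le_rfl, NI_nn := le_rfl, N2_nn := le_rfl,
      B2_nn := le_rfl, θ2_nn := le_rfl, Bl_nn := fun _ _ _ => le_rfl, Bt_nn := fun _ _ _ => le_rfl, BI_nn := fun _ _ _ => le_rfl,
      BI2_nn := fun _ _ _ _ _ _ => le_rfl, θI_nn := fun _ _ => le_rfl }
  have hα : pp.α = 1 / 4 := rfl
  have hδ : pp.δ₀ = s := rfl
  have hF : pp.αF = 1 / 1000 := rfl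
  refine ⟨1 / 2, s, s, 1, 1, 1, 1, 1, pp, pp, ⟨0, 0, 0⟩, ⟨0, 0, 0⟩, ⟨W, BMx, 0⟩, ⟨0, 0, 0⟩,
    9 * s / 20, s / 50, s / 1000, s / 100, 1, 1, 0, s / 20, s / 200, 1 / 8, 0, s / 1000, fun _ => 0, 0, s / 20, s / 25, s / 1000, 0,
    fun _ => 0, fun _ => 0, fun _ => 0, fun _ => 0, fun _ => 0, fun _ _ => 0, 0, s, s / 16, s / 16, fun _ => 0, fun _ => 0, 1, 1, 1,
    by norm_num, by norm_num, hs, le_rfl, by norm_num, by norm_num, by norm_num, by norm_num, by norm_num,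
    hpp, hpp, ⟨le_rfl, le_rfl, le_rfl⟩, ⟨le_rfl, le_rfl, le_rfl⟩, ⟨hW, hBMx.le, le_rfl⟩, ⟨le_rfl, le_rfl, le_rfl⟩,
    le_max_left _ _, le_max_right _ _,
    le_rfl, by positivity, by linarith, by linarith, fun _ => le_rfl, le_rfl,
    by positivity, by positivity, by linarith, by linarith, by linarith, by norm_num, by norm_num, by norm_num, by norm_num, by linarith,
    ?_, le_rfl, by positivity, by linarith, by linarith, by linarith, ?_, le_rfl, le_rfl, by linarith, by positivity, by linarith, by linarith,
    fun _ _ => le_rfl, le_rfl, fun _ _ => le_rfl, fun _ _ _ => le_rfl, fun _ _ _ => le_rfl, fun _ _ _ => le_rfl, fun _ _ _ _ _ _ => le_rfl,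
    le_rfl, ?_, by linarith, by positivity, ?_, fun _ _ _ => le_rfl, fun _ _ _ => le_rfl,
    by norm_num, by norm_num, by norm_num, by linarith, le_rfl, ?_,
    (le_max_left _ _).trans (le_max_right _ _), (min_le_right _ _).trans (min_le_left _ _), le_rfl, hsM,
    (le_max_right _ _).trans (le_max_right _ _), (min_le_right _ _).trans (min_le_right _ _), hsR, ?_, le_rfl⟩
  · rw [hF, hα, hδ]; linarith
  · rw [hF, hα, hδ]; linarith
  · rw [hα, hδ, min_eq_left (by linarith)]; linarith
  · rw [hF, hα, hδ]; linarith
  · rw [hF]; linarith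
  · show (0 : ℝ) * Real.exp ((3 / 4 + s) * 0) * BRc ≤ 0
    simp

end Summit.QuantumFields.YangMills.BalabanUVNodes.N06NumericsWitnessB

end
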